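import Mathlib
import HarnessLib
import Summits.NavierStokesRegularity.NavierStokesRegularity.Theorems.PoloidalWindowDoorLrcModEntireThreadFlatLeafPackage
import Summits.NavierStokesRegularity.NavierStokesRegularity.Theorems.PoloidalWindowDoorLrcModEntireRadialLevels

/-!
# Route `PoloidalWindowDoor`, item `LrcModEntire` (stmt-NavierStokesRegularity-20428) / crux K2 (stmt-19708) —
# one crossing per ray at a quartic-nondegenerate FLAT threaded hot spot

LEAD of item 20428 ns-poloidal-K2-p3 g10 (`--supports stmt-NavierStokesRegularity-20428 --as helper`).
`…ThreadFlatLeafPackage.flatHotSpotLeafPackage` gives, on the plane `{xp + ye}` through the thread, the strict extremum and the radial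
monotonicity `V·Dv₂(−1,·)(z)z < 0`.  Pulling `V·v₂(−1,·)` back to `ℝ × ℝ` by `(x,y) ↦ xp + ye` and applying `…RadialLevels` yields the leaf
geometry used by the axis calculus WITHOUT the Morse hypothesis: along every ray from the thread the function `s ↦ V·v₂(−1, s(ap + be))` is
strictly decreasing on `[0, ρ/‖(a,b)‖)`, and every level between the end value and `V²` is crossed exactly once (`flatHotSpot_rays`).
WHAT THIS IS NOT: not S3′, not a claim about Navier–Stokes regularity — calculus at a hot spot (bears_on LADDER-NS N0, rung N0-LocalTubeDoorPoloidal). [folklore]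
-/

noncomputable section

-- the summit and its single sub-problem share the name (CONVENTIONS §1), as in every Theorems file
set_option linter.dupNamespace false

namespace Summit.NavierStokesRegularity.NavierStokesRegularity.Theorems.PoloidalWindowDoorLrcModEntireThreadFlatLeafRays

open MeasureTheory Set Function Filter Topology Metric
open scoped RealInnerProductSpace InnerProductSpace
open Literature.Analysis Literature.Analysis.FluidPDE Literature.Analysis.UnboundedOperators
open Summit.NavierStokesRegularity.NavierStokesRegularity.Theorems.LocalSineTubeDoorProfileAlignedWindowRigidityAncient
open Summit.NavierStokesRegularity.NavierStokesRegularity.Theorems.PoloidalWindowDoorLrcModEntireThreadFlatLeafPackage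
open Summit.NavierStokesRegularity.NavierStokesRegularity.Theorems.PoloidalWindowDoorLrcModEntireRadialLevels

/-- The plane chart `(x,y) ↦ xp + yq` as a continuous linear map. -/
def planeChart (p q : EuclideanSpace ℝ (Fin 3)) : ℝ × ℝ →L[ℝ] EuclideanSpace ℝ (Fin 3) :=
  (ContinuousLinearMap.fst ℝ ℝ ℝ).smulRight p + (ContinuousLinearMap.snd ℝ ℝ ℝ).smulRight q

/-- `planeChart p q (x,y) = xp + yq`. -/
theorem planeChart_apply (p q : EuclideanSpace ℝ (Fin 3)) (u : ℝ × ℝ) : planeChart p q u = u.1 • p + u.2 • q := by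
  simp [planeChart]

variable {v : ℝ → EuclideanSpace ℝ (Fin 3) → EuclideanSpace ℝ (Fin 3)} {C : ℝ}

/-- **ONE CROSSING PER RAY at a quartic-nondegenerate flat threaded hot spot.**  Under the hypotheses of `flatHotSpotLeafPackage`, with
`G(x,y) := V·v₂(−1, xp + ye)` on `ℝ × ℝ` (sup norm): there is `ρ > 0` such that for every direction `u ≠ 0` the ray function
`s ↦ G(su)` is strictly decreasing on `[0, ρ/‖u‖)`, and for `0 < s₁ < ρ/‖u‖` every level `c` with `G(s₁u) < c < V²` is taken exactly once
on `(0, s₁)`. [folklore] -/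
theorem flatHotSpot_rays (hrate : HasTypeITimeDecay C v) (hcont : ContinuousOn (uncurry v) (Iio (0 : ℝ) ×ˢ univ))
    (hmild : ∀ s t : ℝ, s < t → t < 0 → ∀ x, v t x = heatExtension (v s) (t - s) x - oseenDuhamel 1 s v v t x)
    (hne : v (-1) 0 2 ≠ 0) (hhot : ∀ t < 0, ∀ x, Real.sqrt (-t) * |v t x 2| ≤ |v (-1) 0 2|)
    {e : EuclideanSpace ℝ (Fin 3)} (hflat : fderiv ℝ (fun x => fderiv ℝ (fun y => v (-1) y 2) x e) 0 e = 0)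
    (p : EuclideanSpace ℝ (Fin 3)) (hA0 : iteratedFDeriv ℝ 2 (fun y => v (-1) y 2) 0 ![p, p] ≠ 0)
    (hQ0 : iteratedFDeriv ℝ 4 (fun y => v (-1) y 2) 0 (fun _ => e) ≠ 0)
    (hdisc : 27 * (iteratedDeriv 2 (fun y : ℝ => fderiv ℝ (fun z => v (-1) z 2) (y • e) p) 0) ^ 2 <
      8 * iteratedFDeriv ℝ 2 (fun y => v (-1) y 2) 0 ![p, p] * iteratedFDeriv ℝ 4 (fun y => v (-1) y 2) 0 (fun _ => e)) :
    ∃ ρ > 0, ∀ u : ℝ × ℝ, u ≠ 0 →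
      StrictAntiOn (fun s : ℝ => v (-1) 0 2 * v (-1) ((s • u).1 • p + (s • u).2 • e) 2) (Ico 0 (ρ / ‖u‖)) ∧
      ∀ s₁ c : ℝ, 0 < s₁ → s₁ < ρ / ‖u‖ →
        v (-1) 0 2 * v (-1) ((s₁ • u).1 • p + (s₁ • u).2 • e) 2 < c → c < v (-1) 0 2 * v (-1) 0 2 →
        ∃! s : ℝ, s ∈ Ioo 0 s₁ ∧ v (-1) 0 2 * v (-1) ((s • u).1 • p + (s • u).2 • e) 2 = c := by
  obtain ⟨ρ, hρ, hpack⟩ := flatHotSpotLeafPackage hrate hcont hmild hne hhot hflat p hA0 hQ0 hdisc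
  -- the pulled-back function `G = V · f ∘ planeChart`
  set f : EuclideanSpace ℝ (Fin 3) → ℝ := fun y => v (-1) y 2 with hf
  have hfd : Differentiable ℝ f := by
    have hsl := analyticOnNhd_slice hcont (bdd_of_hasTypeITimeDecay hrate) hmild (by norm_num : (-1 : ℝ) < 0)
    have han : AnalyticOnNhd ℝ f univ := fun y _ =>
      ((EuclideanSpace.proj (𝕜 := ℝ) (2 : Fin 3)).analyticAt _).comp (hsl y (mem_univ _))
    exact fun z => (han z (mem_univ _)).differentiableAt
  set G : ℝ × ℝ → ℝ := fun w => v (-1) 0 2 * f (planeChart p e w) with hG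
  have hGd : ∀ w : ℝ × ℝ, DifferentiableAt ℝ G w := fun w =>
    ((hfd _).comp w (planeChart p e).differentiableAt).const_mul _
  have hGrad : ∀ w ∈ ball (0 : ℝ × ℝ) ρ, w ≠ 0 → fderiv ℝ G w (w - 0) < 0 := by
    intro w hw hw0
    rw [sub_zero]
    have hw' : |w.1| < ρ ∧ |w.2| < ρ := by
      rw [mem_ball, dist_zero_right, Prod.norm_def, max_lt_iff, Real.norm_eq_abs, Real.norm_eq_abs] at hw; exact hw
    have hxy : w.1 ≠ 0 ∨ w.2 ≠ 0 := by
      by_contra h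
      push Not at h
      exact hw0 (Prod.ext h.1 h.2)
    have hcomp : fderiv ℝ (fun w : ℝ × ℝ => f (planeChart p e w)) w = (fderiv ℝ f (planeChart p e w)).comp (planeChart p e) :=
      ((hfd _).hasFDerivAt.comp w (planeChart p e).hasFDerivAt).fderiv
    have hG' : fderiv ℝ G w = v (-1) 0 2 • fderiv ℝ (fun w : ℝ × ℝ => f (planeChart p e w)) w := by
      rw [hG]; exact fderiv_const_mul ((hfd _).comp w (planeChart p e).differentiableAt) _
    rw [hG', hcomp]
    simp only [FunLike.coe_smul, Pi.smul_apply, ContinuousLinearMap.comp_apply, planeChart_apply, smul_eq_mul]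
    exact (hpack w.1 w.2 hw'.1 hw'.2 hxy).2
  refine ⟨ρ, hρ, fun u hu => ⟨?_, ?_⟩⟩
  · have h := strictAntiOn_ray_of_radial_neg (x₀ := (0 : ℝ × ℝ)) (fun w _ => hGd w) hGrad hu
    have hfun : (fun s : ℝ => G (0 + s • u)) = fun s : ℝ => v (-1) 0 2 * v (-1) ((s • u).1 • p + (s • u).2 • e) 2 := by
      funext s; simp [hG, hf, planeChart_apply]
    rw [hfun] at h; exact h
  · intro s₁ c hs₁ hs₁r hc₁ hc₀
    have hc₁' : G (0 + s₁ • u) < c := by simpa [hG, hf, planeChart_apply] using hc₁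
    have hc₀' : c < G 0 := by simpa [hG, hf, planeChart_apply] using hc₀
    have h := existsUnique_level_on_ray (x₀ := (0 : ℝ × ℝ)) (fun w _ => hGd w) hGrad hu hs₁ hs₁r hc₁' hc₀'
    have hfun : ∀ s : ℝ, G (0 + s • u) = v (-1) 0 2 * v (-1) ((s • u).1 • p + (s • u).2 • e) 2 := by
      intro s; simp [hG, hf, planeChart_apply]
    simp only [hfun] at h
    exact h

end Summit.NavierStokesRegularity.NavierStokesRegularity.Theorems.PoloidalWindowDoorLrcModEntireThreadFlatLeafRays
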